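import Summits.Ventures.PercRepro.RLSRuleT1Tools
import Summits.Ventures.PercRepro.RLSRuleTwoLines

/-!
# C-025 at q = 3: the plane «two `3`-point lines through a point» at `t ≥ 1` — geometry and counting (night-3, gen 4)

The pieces of the `t = 1` / `t = 2` accountings of the `TwoLines` plane `G = ℓ ∪ ℓ′` that depend on its shape:

* `twoLines_symm`; `card_dep_ge_of_twoLines` (the lines inside `B′` are dependent triples of `B′`);
* **`wPlus_ge_of_twoLines_exact`** — the EXACT share in a good witness, `ρ₃(B′)/(C(b + x, 3) − [ℓ ⊆ B′] − [ℓ′ ⊆ B′])`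
  (from `wPlus_ge_of_mstar_zero'` and `rho3_add_card_dep_le_choose`): the crude `C(b + x, 3)` of `wPlus_ge_of_twoLines`
  is not enough at `t = 1` for `p ≤ 10`;
* `sum_powersetCard_four_twoLines` — a sum over the five `4`-subsets: two through `ℓ`, two through `ℓ′`, one through
  neither; `twoLines_family` — the `8` independent triples, the `5` four-subsets and `G`: ranks, disjointness, cards;
* `UqG_subset_of_twoLines_t1` / `_t2` — the bottom sets at `t = 1` are among the triples and the `4`-subsets (`≤ 13`),
  at `t = 2` among the triples (`≤ 8`).
Imports `RLSRuleT1Tools`, `RLSRuleTwoLines`.  Axioms: standard.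
-/

open scoped Matroid

namespace PercRepro

namespace NightThree

open Finset ThmH PerFlat

variable {α : Type*} [DecidableEq α] {M : Matroid α} [M.Finite]

/-! ### Tools: symmetry, dependent triples, the exact share -/

omit [DecidableEq α] [M.Finite] in
/-- `TwoLines` is symmetric in the two lines. -/
theorem twoLines_symm {G ℓ ℓ' : Finset α} (h : TwoLines M G ℓ ℓ') : TwoLines M G ℓ' ℓ := by
  obtain ⟨hℓG, hℓ'G, hℓc, hℓ'c, hℓr, hℓ'r, hne, hGc, hsimple, hind⟩ := h
  exact ⟨hℓ'G, hℓG, hℓ'c, hℓc, hℓ'r, hℓr, hne.symm, hGc, hsimple, fun T hT h1 h2 => hind T hT h2 h1⟩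

open scoped Classical in
omit [M.Finite] in
/-- In a subset `B′` of a `TwoLines` plane, the lines inside `B′` are dependent triples of `B′`:
`[ℓ ⊆ B′] + [ℓ′ ⊆ B′] ≤ #dep(B′)`. -/
theorem card_dep_ge_of_twoLines {G ℓ ℓ' B : Finset α} (h : TwoLines M G ℓ ℓ') :
    (if ℓ ⊆ B then 1 else 0) + (if ℓ' ⊆ B then 1 else 0) ≤
      ((B.powersetCard 3).filter (fun (T : Finset α) => ¬ M.Indep (T : Set α))).card := by
  obtain ⟨hℓG, hℓ'G, hℓc, hℓ'c, hℓr, hℓ'r, hne, hGc, hsimple, hind⟩ := h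
  have hmem : ∀ m : Finset α, m ⊆ B → m.card = 3 → ¬ M.Indep (m : Set α) →
      m ∈ (B.powersetCard 3).filter (fun (T : Finset α) => ¬ M.Indep (T : Set α)) := by
    intro m hm hmc hmd
    rw [Finset.mem_filter, Finset.mem_powersetCard]
    exact ⟨⟨hm, hmc⟩, hmd⟩
  have hℓd := not_indep_of_eRk_two_card_three (M := M) hℓr hℓc
  have hℓ'd := not_indep_of_eRk_two_card_three (M := M) hℓ'r hℓ'c
  by_cases h1 : ℓ ⊆ B <;> by_cases h2 : ℓ' ⊆ B
  · rw [if_pos h1, if_pos h2]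
    have hsub : ({ℓ, ℓ'} : Finset (Finset α)) ⊆
        (B.powersetCard 3).filter (fun (T : Finset α) => ¬ M.Indep (T : Set α)) := by
      intro T hT
      rw [Finset.mem_insert, Finset.mem_singleton] at hT
      rcases hT with rfl | rfl
      · exact hmem _ h1 hℓc hℓd
      · exact hmem _ h2 hℓ'c hℓ'd
    have := Finset.card_le_card hsub
    rw [Finset.card_pair hne] at this
    exact this
  · rw [if_pos h1, if_neg h2]
    exact Finset.card_pos.2 ⟨ℓ, hmem _ h1 hℓc hℓd⟩
  · rw [if_neg h1, if_pos h2]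
    exact Finset.card_pos.2 ⟨ℓ', hmem _ h2 hℓ'c hℓ'd⟩
  · rw [if_neg h1, if_neg h2]
    exact Nat.zero_le _

/-- **The exact share in a good witness.**  For `B′ ⊆ G` (`TwoLines`) and a witness `X` good for the lines inside
`B′`, `G` receives at least `ρ₃(B′) / (C(b + x, 3) − [ℓ ⊆ B′] − [ℓ′ ⊆ B′])` in `B′ ∪ X` — the crude `C(b + x, 3)`
is not enough at `t = 1` for `p ≤ 10`. -/
theorem wPlus_ge_of_twoLines_exact {G ℓ ℓ' K B X : Finset α} (hG : G ∈ flatsQ M 3) (h : TwoLines M G ℓ ℓ')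
    (hB : B ⊆ G) (hX : M.Indep (X : Set α)) (hXG : Disjoint X G) (hXK : X ⊆ K)
    (hgood : (ℓ ⊆ B → GoodWitness M ℓ K X) ∧ (ℓ' ⊆ B → GoodWitness M ℓ' K X)) :
    ((B.card.choose 3 - (if ℓ ⊆ B then 1 else 0) - (if ℓ' ⊆ B then 1 else 0) : ℕ) : ℚ) /
        ((((B.card + X.card).choose 3 : ℕ) : ℚ) - (if ℓ ⊆ B then 1 else 0) - (if ℓ' ⊆ B then 1 else 0)) ≤
      wPlus M G (B ∪ X) := by
  classical
  have hS : B ∪ X ⊆ gr M := by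
    apply Finset.union_subset (hB.trans (mem_flatsQ.1 hG).1)
    rw [← Finset.coe_subset, coe_gr]
    exact hX.subset_ground
  have hm := mstar_union_eq_zero_of_twoLines hG h hB hX hXG hXK hgood
  have hdep := card_dep_ge_of_twoLines (M := M) (B := B) h
  have hle := rho3_add_card_dep_le_choose (M := M) (S := B ∪ X) (B := B) Finset.subset_union_left
  have hdisj : Disjoint B X := (Finset.disjoint_of_subset_right hB hXG).symm
  have hD : (rho3 M (B ∪ X) : ℚ) ≤
      (((B.card + X.card).choose 3 : ℕ) : ℚ) - (if ℓ ⊆ B then 1 else 0) - (if ℓ' ⊆ B then 1 else 0) := by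
    rw [← Finset.card_union_of_disjoint hdisj]
    have h1 : rho3 M (B ∪ X) + ((if ℓ ⊆ B then 1 else 0) + (if ℓ' ⊆ B then 1 else 0)) ≤
        (B ∪ X).card.choose 3 := by omega
    have h2 : ((rho3 M (B ∪ X) : ℕ) : ℚ) +
        ((((if ℓ ⊆ B then 1 else 0) + (if ℓ' ⊆ B then 1 else 0) : ℕ)) : ℚ) ≤
        (((B ∪ X).card.choose 3 : ℕ) : ℚ) := by exact_mod_cast h1
    push_cast at h2
    linarith
  have hw := wPlus_ge_of_mstar_zero' hS hm G hD
  rw [inter_union_eq_of_disjoint hB hXG, rho3_of_twoLines h hB] at hw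
  exact hw

/-! ### The `4`-subsets of a `TwoLines` plane, summed by the line they contain -/

/-- Summing over the five `4`-subsets of a `TwoLines` plane: two through `ℓ`, two through `ℓ′`, one through neither. -/
theorem sum_powersetCard_four_twoLines {G ℓ ℓ' : Finset α} (hG : G ∈ flatsQ M 3) (h : TwoLines M G ℓ ℓ')
    (g : Finset α → ℚ) {vL vL' vg : ℚ}
    (hL : ∀ B ∈ G.powersetCard 4, ℓ ⊆ B → g B = vL) (hL' : ∀ B ∈ G.powersetCard 4, ℓ' ⊆ B → g B = vL')
    (hg : ∀ B ∈ G.powersetCard 4, ¬ ℓ ⊆ B → ¬ ℓ' ⊆ B → g B = vg) :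
    ∑ B ∈ G.powersetCard 4, g B = 2 * vL + 2 * vL' + vg := by
  classical
  obtain ⟨hℓG, hℓ'G, hℓc, hℓ'c, hℓr, hℓ'r, hne, hGc, hsimple, hind⟩ := h
  have h' : TwoLines M G ℓ ℓ' := ⟨hℓG, hℓ'G, hℓc, hℓ'c, hℓr, hℓ'r, hne, hGc, hsimple, hind⟩
  have hnotboth : ∀ B ∈ G.powersetCard 4, ¬ (ℓ ⊆ B ∧ ℓ' ⊆ B) := by
    rintro B hB ⟨hl, hl'⟩
    have : ℓ ∪ ℓ' ⊆ B := Finset.union_subset hl hl'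
    rw [union_eq_of_twoLines hG h'] at this
    have := Finset.card_le_card this
    rw [(Finset.mem_powersetCard.1 hB).2] at this
    omega
  set P := G.powersetCard 4 with hP
  have hPc : P.card = 5 := by rw [hP, Finset.card_powersetCard, hGc]; rfl
  have hcL : (P.filter (fun B => ℓ ⊆ B)).card = 2 := card_filter_four_line hℓG hℓc hGc
  have hcL' : (P.filter (fun B => ℓ' ⊆ B)).card = 2 := card_filter_four_line hℓ'G hℓ'c hGc
  -- the second filter inside the complement of the first
  have hfilt : (P.filter (fun B => ¬ ℓ ⊆ B)).filter (fun B => ℓ' ⊆ B) = P.filter (fun B => ℓ' ⊆ B) := by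
    ext B
    simp only [Finset.mem_filter]
    constructor
    · rintro ⟨⟨hB, _⟩, hl'⟩; exact ⟨hB, hl'⟩
    · rintro ⟨hB, hl'⟩; exact ⟨⟨hB, fun hl => hnotboth B hB ⟨hl, hl'⟩⟩, hl'⟩
  have hcrest : ((P.filter (fun B => ¬ ℓ ⊆ B)).filter (fun B => ¬ ℓ' ⊆ B)).card = 1 := by
    have h1 := Finset.card_filter_add_card_filter_not (s := P) (fun B => ℓ ⊆ B)
    have h2 := Finset.card_filter_add_card_filter_not (s := P.filter (fun B => ¬ ℓ ⊆ B)) (fun B => ℓ' ⊆ B)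
    rw [hfilt, hcL'] at h2
    rw [hcL, hPc] at h1
    omega
  rw [← Finset.sum_filter_add_sum_filter_not P (fun B => ℓ ⊆ B),
    ← Finset.sum_filter_add_sum_filter_not (P.filter (fun B => ¬ ℓ ⊆ B)) (fun B => ℓ' ⊆ B), hfilt]
  rw [Finset.sum_congr rfl (fun B hB => hL B (Finset.mem_filter.1 hB).1 (Finset.mem_filter.1 hB).2),
    Finset.sum_congr rfl (fun B hB => hL' B (Finset.mem_filter.1 hB).1 (Finset.mem_filter.1 hB).2),
    Finset.sum_congr rfl (fun B hB => hg B (Finset.mem_filter.1 (Finset.mem_filter.1 hB).1).1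
      (Finset.mem_filter.1 (Finset.mem_filter.1 hB).1).2 (Finset.mem_filter.1 hB).2),
    Finset.sum_const, Finset.sum_const, Finset.sum_const, hcL, hcL', hcrest]
  simp only [nsmul_eq_mul]
  push_cast
  ring

/-! ### The family of rank-`3` subsets and the demand at `t = 1`, `t = 2` -/

/-- The `8` independent triples, the `5` four-subsets and `G` itself: every member has rank `3`; the pieces are
disjoint; the demand at `t = 1` is inside the first two pieces (`≤ 13`), at `t = 2` inside the first (`≤ 8`). -/
theorem twoLines_family {G ℓ ℓ' : Finset α} (hG : G ∈ flatsQ M 3) (h : TwoLines M G ℓ ℓ') :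
    (∀ B ∈ ((G.powersetCard 3).erase ℓ).erase ℓ', B ⊆ G ∧ B.card = 3 ∧ ¬ ℓ ⊆ B ∧ ¬ ℓ' ⊆ B ∧ M.Indep (B : Set α)) ∧
    (∀ B ∈ ((G.powersetCard 3).erase ℓ).erase ℓ' ∪ G.powersetCard 4 ∪ {G}, B ⊆ G ∧ M.eRk (B : Set α) = 3) ∧
    Disjoint (((G.powersetCard 3).erase ℓ).erase ℓ') (G.powersetCard 4) ∧
    Disjoint (((G.powersetCard 3).erase ℓ).erase ℓ' ∪ G.powersetCard 4) {G} ∧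
    (((G.powersetCard 3).erase ℓ).erase ℓ').card = 8 ∧ (G.powersetCard 4).card = 5 := by
  classical
  obtain ⟨hℓG, hℓ'G, hℓc, hℓ'c, hℓr, hℓ'r, hne, hGc, hsimple, hind⟩ := h
  have h' : TwoLines M G ℓ ℓ' := ⟨hℓG, hℓ'G, hℓc, hℓ'c, hℓr, hℓ'r, hne, hGc, hsimple, hind⟩
  have hG3 : M.eRk (G : Set α) = 3 := eRk_eq_three_of_mem_flatsQ' hG
  have hmem3 : ∀ B ∈ ((G.powersetCard 3).erase ℓ).erase ℓ',
      B ⊆ G ∧ B.card = 3 ∧ ¬ ℓ ⊆ B ∧ ¬ ℓ' ⊆ B ∧ M.Indep (B : Set α) := by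
    intro B hB
    rw [Finset.mem_erase, Finset.mem_erase, Finset.mem_powersetCard] at hB
    obtain ⟨hBℓ', hBℓ, hBG, hBc⟩ := hB
    refine ⟨hBG, hBc, ?_, ?_, hind B (Finset.mem_powersetCard.2 ⟨hBG, hBc⟩) hBℓ hBℓ'⟩
    · intro hl; exact hBℓ (Finset.eq_of_subset_of_card_le hl (by omega)).symm
    · intro hl; exact hBℓ' (Finset.eq_of_subset_of_card_le hl (by omega)).symm
  refine ⟨hmem3, ?_, ?_, ?_, ?_, ?_⟩
  · intro B hB
    rw [Finset.mem_union, Finset.mem_union, Finset.mem_singleton] at hB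
    rcases hB with (hB | hB) | hBG'
    · obtain ⟨hBG, hBc, _, _, hBind⟩ := hmem3 B hB
      exact ⟨hBG, eRk_eq_three_of_indep_card hBind hBc⟩
    · obtain ⟨hBG, hBc⟩ := Finset.mem_powersetCard.1 hB
      refine ⟨hBG, le_antisymm ?_ ?_⟩
      · rw [← hG3]; exact M.eRk_mono (Finset.coe_subset.2 hBG)
      · obtain ⟨T, hTB, hTc, hTind⟩ := exists_indep_triple_of_four h' hBG hBc
        rw [← eRk_eq_three_of_indep_card hTind hTc]
        exact M.eRk_mono (Finset.coe_subset.2 hTB)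
    · rw [hBG']; exact ⟨le_rfl, hG3⟩
  · rw [Finset.disjoint_left]
    intro B h3 h4
    have := (hmem3 B h3).2.1
    have := (Finset.mem_powersetCard.1 h4).2
    omega
  · rw [Finset.disjoint_right]
    intro B hB
    rw [Finset.mem_singleton] at hB
    rw [hB, Finset.mem_union]
    rintro (h3 | h4)
    · have := (hmem3 G h3).2.1; omega
    · have := (Finset.mem_powersetCard.1 h4).2; omega
  · rw [Finset.card_erase_of_mem, Finset.card_erase_of_mem (Finset.mem_powersetCard.2 ⟨hℓG, hℓc⟩),
      Finset.card_powersetCard, hGc]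
    · rfl
    · rw [Finset.mem_erase, Finset.mem_powersetCard]; exact ⟨hne.symm, hℓ'G, hℓ'c⟩
  · rw [Finset.card_powersetCard, hGc]; rfl

/-- At `t = 1` the bottom sets of a `TwoLines` plane are among the `8` triples and the `5` four-subsets. -/
theorem UqG_subset_of_twoLines_t1 {G ℓ ℓ' : Finset α} {n : ℕ} (h : TwoLines M G ℓ ℓ')
    (hK : M.eRk ((gr M \ G : Finset α) : Set α) = ((n + 3 : ℕ) : ℕ∞)) :
    UqG M (n + 4) 3 G ⊆ ((G.powersetCard 3).erase ℓ).erase ℓ' ∪ G.powersetCard 4 := by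
  obtain ⟨hℓG, hℓ'G, hℓc, hℓ'c, hℓr, hℓ'r, hne, hGc, hsimple, hind⟩ := h
  intro B hB
  have hle := card_add_le_of_mem_UqG hB hK (by omega : n + 3 + 1 ≤ n + 4)
  have hB' := hB
  unfold UqG at hB'
  rw [Finset.mem_filter, mem_Uq] at hB'
  obtain ⟨⟨_, hB3, _⟩, hBG⟩ := hB'
  have hB3' : M.eRk (B : Set α) = 3 := by exact_mod_cast hB3
  have hBc := three_le_card_of_eRk_eq_three hB3'
  rw [Finset.mem_union]
  rcases Nat.lt_or_ge B.card 4 with h3 | h4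
  · left
    rw [Finset.mem_erase, Finset.mem_erase, Finset.mem_powersetCard]
    refine ⟨?_, ?_, hBG, by omega⟩
    · rintro rfl; rw [hℓ'r] at hB3'; exact absurd hB3' (by decide)
    · rintro rfl; rw [hℓr] at hB3'; exact absurd hB3' (by decide)
  · right
    rw [Finset.mem_powersetCard]; exact ⟨hBG, by omega⟩

/-- At `t = 2` the bottom sets of a `TwoLines` plane are among the `8` independent triples. -/
theorem UqG_subset_of_twoLines_t2 {G ℓ ℓ' : Finset α} {n : ℕ} (h : TwoLines M G ℓ ℓ')
    (hK : M.eRk ((gr M \ G : Finset α) : Set α) = ((n + 2 : ℕ) : ℕ∞)) :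
    UqG M (n + 4) 3 G ⊆ ((G.powersetCard 3).erase ℓ).erase ℓ' := by
  obtain ⟨hℓG, hℓ'G, hℓc, hℓ'c, hℓr, hℓ'r, hne, hGc, hsimple, hind⟩ := h
  intro B hB
  have hle := card_add_le_of_mem_UqG hB hK (by omega : n + 2 + 2 ≤ n + 4)
  have hB' := hB
  unfold UqG at hB'
  rw [Finset.mem_filter, mem_Uq] at hB'
  obtain ⟨⟨_, hB3, _⟩, hBG⟩ := hB'
  have hB3' : M.eRk (B : Set α) = 3 := by exact_mod_cast hB3
  have hBc := three_le_card_of_eRk_eq_three hB3'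
  rw [Finset.mem_erase, Finset.mem_erase, Finset.mem_powersetCard]
  refine ⟨?_, ?_, hBG, by omega⟩
  · rintro rfl; rw [hℓ'r] at hB3'; exact absurd hB3' (by decide)
  · rintro rfl; rw [hℓr] at hB3'; exact absurd hB3' (by decide)

end NightThree

end PercRepro
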